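import Literature.NumberTheory.EllipticCurves.LocalTateDualityPointsLevel
import Literature.NumberTheory.GaloisRepresentations.DiscreteModuleInverseLimitH1
import HarnessLib

/-!
# Local Tate duality with the Kummer image: every additive `φ : E(F) → ℤ_p` is `⟨y, κ(·)⟩` for a class `y ∈ H¹(F, T_pW)`

Topic `NumberTheory/EllipticCurves`; namespace `Literature.NumberTheory.EllipticCurves`. Sequel of `LocalTateDualityPointsLevel.lean`
(brick K2 floor (d) of the hT₂ programme of crux K★ stmt-BirchSwinnertonDyer-22226, memo `Summits/BirchSwinnertonDyer/BirchSwinnertonDyer/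
Cruxes/StarredOptimalManinUnitFiveSeven/Lines/kato-lever-hT2-programme.md` §4): the LAST step of [TD] — lifting the coherent family of
level classes `(x_k)_k` of `exists_coherent_levelTatePairing_kummerLevelClass_eq` to ONE continuous crossed homomorphism of
`T_pW|_{Γ_F}` (NSW (2.7.5): `H¹(lim) ↠ lim H¹` for a tower of finite modules with surjective transitions, the tree's
`DiscreteInvSystem.exists_oneCocycle_proj_eq`). Definitions with bodies and theorems; no named fact, no instance, no `sorry`.

* `torsionInvSystem W F p` — the tower `(E[p^k]|_{Γ_F})_k` with transitions `p^{m−k} : E[p^m] → E[p^k]` as a `DiscreteInvSystem`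
  (`torsionMulHom` = the tree's `geomTorsionZSMul`); `torsionInvSystem_red_surjective` (divisibility of `E(K̄₀)`);
* `tateModuleOfLimit` / `tateModuleOfLimitMor` — the comparison `lim_k E[p^k]|_{Γ_F} ⟶ T_pW|_{Γ_F}` (`TateModule.mk` on compatible
  families; continuous, `Γ_F`-equivariant) and `tateProjMor_comp` (`pr_k ∘ (comparison) = proj_k`);
* `cohomologyMap_redHom_of_succ` — successive compatibility `p_* x_{k+1} = x_k` gives compatibility along all `k ≤ m`;
* ★ `exists_oneCocycle_tateProj_eq` — a coherent family of level classes is the family of projections of ONE continuous crossed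
  homomorphism `η : Γ_F → T_pW`;
* ★★★ `exists_tatePairingPoint_eq` — **[TD]: for every additive `φ : E(F) → ℤ_p` there is `y ∈ H¹(F, T_pW|_{Γ_F})` with
  `⟨y, P⟩ = φ(P)` for all `P ∈ E(F)`** (`tatePairingPoint` of `LocalTatePairingPoints.lean`), i.e. the hypothesis `htd` of the assembly
  `PAdicHodge.range_expStarCoord_smul_iff_of_reciprocity` / `exists_smul_range_tower_of_reciprocity` for the tree's pairing, up to the
  passage from classes to cocycles (`oneCocycleClass_surjective`).

With this file hT₂ (`PAdicHodge.exists_smul_range_expStarCoord_tower_iff_trace_log`) is reduced to [REC] (Kato II Thm. 1.4.1 (4) for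
`V_pE`), [N] and [ADD] only. BSD is not proved by any of this.

## References
* J. Neukirch, A. Schmidt, K. Wingberg (2008), II §7 (2.7.5), (7.2.6). [NeukirchSchmidtWingberg2008]
* J. S. Milne, *Arithmetic Duality Theorems* (2006), I Cor. 2.3, I §3 Cor. 3.4. [MilneADT2006]
* S. Bloch, K. Kato (1990), Prop. 3.8. [BlochKato1990]
* J. H. Silverman, *AEC* (2009), III §7, VIII §2. [SilvermanAEC2009]
-/

noncomputable section

open scoped Classical

open CategoryTheory Function Field
open Literature.NumberTheory.GaloisRepresentations
open Literature.NumberTheory.GaloisRepresentations.DiscreteGaloisModule (mu MuCarrier)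
open Literature.NumberTheory.PAdicHodge (restrictedTateRep restrictedTateRep_apply_apply)
open Literature.AnabelianGeometry.AbsoluteAnabelian (Prop121vii.invLevel)

namespace Literature.NumberTheory.EllipticCurves

open _root_.WeierstrassCurve

attribute [local instance] absoluteGaloisGroup_compactSpace
attribute [local instance] finite_geomTorsion_of_neZero

variable {K₀ : Type} [Field K₀] [CharZero K₀] (W : WeierstrassCurve K₀) [W.IsElliptic] (F : Type) [Field F]
  [Algebra K₀ F] (p : ℕ) [hp : Fact p.Prime]

/-- `p^k ≠ 0`: instance bookkeeping for the levels. [folklore] -/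
private theorem neZero_pow₃ (k : ℕ) : NeZero (p ^ k) := ⟨pow_ne_zero k hp.out.ne_zero⟩

attribute [local instance] neZero_pow₃

omit [CharZero K₀] [W.IsElliptic] hp in
/-- Level arithmetic: `p^k · p^{m−k} = p^m` for `k ≤ m`. [folklore] -/
private theorem pow_mul_pow_sub {k m : ℕ} (h : k ≤ m) : p ^ k * p ^ (m - k) = p ^ m := by
  rw [← pow_add, Nat.add_sub_cancel' h]

/-! ### The torsion tower as an inverse system -/

omit [CharZero K₀] in
/-- **The tower `(E[p^k]|_{Γ_F})_k`** with transition maps `p^{m−k} : E[p^m] → E[p^k]` (`torsionMulHom`, i.e. the tree's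
`geomTorsionZSMul`), as a `DiscreteInvSystem` over `(ℕ, ≤)`. [cite: NeukirchSchmidtWingberg2008, II §7 (2.7.5)] -/
def torsionInvSystem : DiscreteInvSystem (absoluteGaloisGroup F) (fun k : ℕ => geomTorsion W ((p ^ k : ℕ) : ℤ)) where
  le k m := k ≤ m
  le_refl k := le_refl k
  le_trans h₁ h₂ := h₁.trans h₂
  ρ k := torsionRestricted W F (p ^ k)
  red {k m} h := torsionMulHom W (p ^ m) (p ^ k) (p ^ (m - k)) (pow_mul_pow_sub p h)
  red_smul h σ x := torsionMulHom_smul W F _ _ _ _ σ x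
  red_refl k x := Subtype.ext (by
    rw [coe_torsionMulHom, Nat.sub_self, pow_zero, Nat.cast_one, one_smul])
  red_trans {a b c} h₁ h₂ x := Subtype.ext (by
    rw [coe_torsionMulHom, coe_torsionMulHom, coe_torsionMulHom, smul_smul, ← Nat.cast_mul, ← pow_add,
      show b - a + (c - b) = c - a by omega])

omit [CharZero K₀] [W.IsElliptic] hp in
/-- Unfolding the transition maps of `torsionInvSystem` on underlying points: `p^{m−k} • T`. [cite: NeukirchSchmidtWingberg2008, II §7 (2.7.5)] -/
@[simp] theorem coe_torsionInvSystem_red {k m : ℕ} (h : k ≤ m) (T : geomTorsion W ((p ^ m : ℕ) : ℤ)) :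
    (((torsionInvSystem W F p).red h T : geomTorsion W ((p ^ k : ℕ) : ℤ)) : geomPoints W) =
      ((p ^ (m - k) : ℕ) : ℤ) • (T : geomPoints W) := rfl

omit [CharZero K₀] in
/-- The cofinal chain `0 ≤ 1 ≤ 2 ≤ ⋯` of `torsionInvSystem`. [cite: NeukirchSchmidtWingberg2008, II §7 (2.7.5)] -/
def torsionInvSystemChain : (torsionInvSystem W F p).CofinalChain where
  seq i := i
  le_succ i := Nat.le_succ i
  cofinal n := ⟨n, le_refl n⟩

omit [CharZero K₀] in
/-- **The transition maps are surjective** (`E(K̄₀)` is divisible: `zsmul_surjective_of_isAlgClosed`).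
[cite: SilvermanAEC2009, III §7] -/
theorem torsionInvSystem_red_surjective {k m : ℕ} (h : k ≤ m) : Surjective ((torsionInvSystem W F p).red h) := by
  intro T
  have hd : ((p ^ (m - k) : ℕ) : ℤ) ≠ 0 := by exact_mod_cast pow_ne_zero _ hp.out.ne_zero
  obtain ⟨Q, hQ⟩ := (W.baseChange (AlgebraicClosure K₀)).zsmul_surjective_of_isAlgClosed hd (T : geomPoints W)
  have hQ : ((p ^ (m - k) : ℕ) : ℤ) • Q = (T : geomPoints W) := hQ
  have hQm : ((p ^ m : ℕ) : ℤ) • Q = 0 := by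
    rw [← pow_mul_pow_sub p h, Nat.cast_mul, mul_smul]
    change ((p ^ k : ℕ) : ℤ) • (((p ^ (m - k) : ℕ) : ℤ) • Q) = 0
    rw [hQ]
    exact T.2
  exact ⟨⟨Q, hQm⟩, Subtype.ext hQ⟩

/-! ### The comparison `lim_k E[p^k] → T_pW` -/

omit [CharZero K₀] [W.IsElliptic] hp in
/-- Successive compatibility of a family in the limit: `p • x_{k+1} = x_k`. [cite: SilvermanAEC2009, III §7] -/
private theorem limit_succ (x : (torsionInvSystem W F p).limit) (k : ℕ) :
    p • (((x : ∀ k, geomTorsion W ((p ^ k : ℕ) : ℤ)) (k + 1) : geomTorsion W ((p ^ (k + 1) : ℕ) : ℤ)) : geomPoints W) =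
      (((x : ∀ k, geomTorsion W ((p ^ k : ℕ) : ℤ)) k : geomTorsion W ((p ^ k : ℕ) : ℤ)) : geomPoints W) := by
  have h : ((p ^ (k + 1 - k) : ℕ) : ℤ) •
      (((x : ∀ k, geomTorsion W ((p ^ k : ℕ) : ℤ)) (k + 1) : geomTorsion W ((p ^ (k + 1) : ℕ) : ℤ)) : geomPoints W) =
      (((x : ∀ k, geomTorsion W ((p ^ k : ℕ) : ℤ)) k : geomTorsion W ((p ^ k : ℕ) : ℤ)) : geomPoints W) :=
    congrArg Subtype.val ((torsionInvSystem W F p).red_apply_coe x (Nat.le_succ k))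
  rw [Nat.add_sub_cancel_left, pow_one, natCast_zsmul] at h
  exact h

omit [CharZero K₀] [W.IsElliptic] in
/-- **The comparison map `lim_k E[p^k] → T_pW`** (`TateModule.mk` on compatible families), additive.
[cite: SilvermanAEC2009, III §7] -/
def tateModuleOfLimit : (torsionInvSystem W F p).limit →+ W.tateModule p where
  toFun x := TateModule.mk (fun k => (((x : ∀ k, geomTorsion W ((p ^ k : ℕ) : ℤ)) k : geomTorsion W ((p ^ k : ℕ) : ℤ)) :
      geomPoints W))
    (fun k => by
      rw [← natCast_zsmul]
      exact ((x : ∀ k, geomTorsion W ((p ^ k : ℕ) : ℤ)) k).2)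
    (limit_succ W F p x)
  map_zero' := TateModule.ext fun k => rfl
  map_add' x y := TateModule.ext fun k => rfl

omit [CharZero K₀] [W.IsElliptic] hp in
/-- Coordinates of the comparison map. [cite: SilvermanAEC2009, III §7] -/
@[simp] theorem proj_tateModuleOfLimit (x : (torsionInvSystem W F p).limit) (k : ℕ) :
    TateModule.proj p k (tateModuleOfLimit W F p x) =
      (((x : ∀ k, geomTorsion W ((p ^ k : ℕ) : ℤ)) k : geomTorsion W ((p ^ k : ℕ) : ℤ)) : geomPoints W) := rfl

omit [CharZero K₀] [W.IsElliptic] hp in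
/-- The comparison map is continuous (product topologies on both sides). [cite: SilvermanAEC2009, III §7] -/
theorem continuous_tateModuleOfLimit : Continuous (tateModuleOfLimit W F p) := by
  refine continuous_induced_rng.2 (continuous_pi fun k => ?_)
  exact continuous_subtype_val.comp ((continuous_apply k).comp continuous_subtype_val)

omit [CharZero K₀] in
/-- **The comparison `lim_k E[p^k]|_{Γ_F} ⟶ T_pW|_{Γ_F}` as a morphism of topological `Γ_F`-representations.**
[cite: SilvermanAEC2009, III §7] -/
def tateModuleOfLimitMor : (torsionInvSystem W F p).limitRep.toTopRep ⟶ (restrictedTateRep W F p).toTopRep :=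
  TopRep.ofHom
    { toFun := tateModuleOfLimit W F p
      map_add' := map_add _
      map_smul' := fun c x => map_zsmul _ c x
      cont := continuous_tateModuleOfLimit W F p
      isIntertwining' := fun σ => ContinuousLinearMap.ext fun x => TateModule.ext fun k => by
        change TateModule.proj p k (tateModuleOfLimit W F p ((torsionInvSystem W F p).limitRep σ x)) =
          TateModule.proj p k (restrictedTateRep W F p σ (tateModuleOfLimit W F p x))
        rw [restrictedTateRep_apply_apply, TateModule.proj_smul_of_distribMulAction, proj_tateModuleOfLimit,
          proj_tateModuleOfLimit]
        rfl }

omit [CharZero K₀] [W.IsElliptic] in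
/-- `pr_k ∘ (comparison) = proj_k` pointwise. [cite: SilvermanAEC2009, III §7] -/
theorem tateProjMor_tateModuleOfLimitMor (k : ℕ) (x : (torsionInvSystem W F p).limit) :
    (tateProjMor W F p k).hom ((tateModuleOfLimitMor W F p).hom x) = ((torsionInvSystem W F p).projHom k).hom x :=
  Subtype.ext rfl

/-! ### From a coherent family of level classes to one class of `H¹(F, T_pW)` -/

omit [CharZero K₀] [W.IsElliptic] hp in
/-- Successive compatibility `p_* x_{k+1} = x_k` gives compatibility along every `k ≤ m` in the tower.
[cite: NeukirchSchmidtWingberg2008, II §7 (2.7.5)] -/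
theorem cohomologyMap_redHom_of_succ (x : ∀ k, continuousCohomology 1 (torsionRestricted W F (p ^ k)).toTopRep)
    (hx : ∀ k, (cohomologyMap (torsionMulMor W F (p ^ (k + 1)) (p ^ k) p (pow_succ p k).symm) 1).hom (x (k + 1)) = x k)
    {k m : ℕ} (h : k ≤ m) : (cohomologyMap ((torsionInvSystem W F p).redHom h) 1).hom (x m) = x k := by
  induction h with
  | refl =>
    have hid : cohomologyMap ((torsionInvSystem W F p).redHom (le_refl k)) 1 = 𝟙 _ :=
      map_id_eq_id _ (fun T => (torsionInvSystem W F p).red_refl k T) 1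
    rw [hid]; rfl
  | @step m hkm ih =>
    have hkm' : k ≤ m := hkm
    rw [← ih, ← hx m]
    refine cohomologyMap_comp_apply_of_eq _ _ _ (fun T => Subtype.ext ?_) 1 (x (m + 1)) |>.symm
    change ((p ^ (m - k) : ℕ) : ℤ) • ((p : ℤ) • (T : geomPoints W)) = ((p ^ (m + 1 - k) : ℕ) : ℤ) • (T : geomPoints W)
    rw [smul_smul, ← Nat.cast_mul, ← pow_succ, show m - k + 1 = m + 1 - k by omega]

omit [CharZero K₀] in
/-- ★ **A coherent family of level classes comes from ONE continuous crossed homomorphism of `T_pW|_{Γ_F}`**: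
`pr_k [η] = x_k` for all `k` (NSW (2.7.5) surjectivity for the tower of finite modules `E[p^k]` with surjective transitions, the
tree's `DiscreteInvSystem.exists_oneCocycle_proj_eq`, pushed to `T_pW` along the comparison map).
[cite: NeukirchSchmidtWingberg2008, II §7 (2.7.5)] -/
theorem exists_oneCocycle_tateProj_eq (x : ∀ k, continuousCohomology 1 (torsionRestricted W F (p ^ k)).toTopRep)
    (hx : ∀ k, (cohomologyMap (torsionMulMor W F (p ^ (k + 1)) (p ^ k) p (pow_succ p k).symm) 1).hom (x (k + 1)) = x k) :
    ∃ η : contOneCocycles (restrictedTateRep W F p).toTopRep,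
      ∀ k, (cohomologyMap (tateProjMor W F p k) 1).hom (oneCocycleClass _ η) = x k := by
  obtain ⟨f, hf⟩ := (torsionInvSystem W F p).exists_oneCocycle_proj_eq (torsionInvSystemChain W F p)
    (fun h => torsionInvSystem_red_surjective W F p h) x (fun h => cohomologyMap_redHom_of_succ W F p x hx h)
  refine ⟨contOneCocycles.pullback (ContinuousMonoidHom.id _) (resIdHom (tateModuleOfLimitMor W F p)) f, fun k => ?_⟩
  rw [← hf k, cohomologyMap_oneCocycleClass]
  exact congrArg (oneCocycleClass _) (Subtype.ext (ContinuousMap.ext fun σ =>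
    tateProjMor_tateModuleOfLimitMor W F p k (f.1 σ)))

/-! ### [TD]: every additive `φ : E(F) → ℤ_p` is `⟨y, κ(·)⟩` -/

variable (e : (k : ℕ) → geomTorsion W ((p ^ k : ℕ) : ℤ) → geomTorsion W ((p ^ k : ℕ) : ℤ) → AlgebraicClosure K₀)
  (hμ : ∀ k S T, e k S T ^ (p ^ k) = 1)
  (hadd₁ : ∀ k S₁ S₂ T, e k (S₁ + S₂) T = e k S₁ T * e k S₂ T)
  (hadd₂ : ∀ k S T₁ T₂, e k S (T₁ + T₂) = e k S T₁ * e k S T₂)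
  (hgal : ∀ k (σ : absoluteGaloisGroup K₀) (S T : geomTorsion W ((p ^ k : ℕ) : ℤ)),
    σ • e k S T = e k (σ • S) (σ • T))
  (hnondeg : ∀ k (T : geomTorsion W ((p ^ k : ℕ) : ℤ)), (∀ S, e k S T = 1) → T = 0)
  (hcompat : ∀ k (S T : geomTorsion W ((p ^ (k + 1) : ℕ) : ℤ)),
    e k (torsionMulHom W (p ^ (k + 1)) (p ^ k) p (pow_succ p k).symm S)
      (torsionMulHom W (p ^ (k + 1)) (p ^ k) p (pow_succ p k).symm T) = e (k + 1) S T ^ p)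

variable [CharZero F] [ValuativeRel F] [TopologicalSpace F] [IsNonarchimedeanLocalField F]

include hnondeg in
/-- ★★★ **[TD] — local Tate duality with the Kummer image for `T_pE`**: over a non-archimedean local field `F ⊇ K₀` of
characteristic `0`, for every additive `φ : E(F) → ℤ_p` there is a class `y ∈ H¹(F, T_pW|_{Γ_F})` with `⟨y, P⟩ = φ(P)` for all
`P ∈ E(F)` (the `ℤ_p`-valued pairing `tatePairingPoint` of `LocalTatePairingPoints.lean` for THE invariant maps): levelwise duality and
coherent choice (`exists_coherent_levelTatePairing_kummerLevelClass_eq`) + the lift `exists_oneCocycle_tateProj_eq` + `p`-adic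
separatedness. [cite: MilneADT2006, I Cor. 2.3 and I §3 Cor. 3.4] [cite: BlochKato1990, Prop. 3.8 (p. 354)] [cite: NeukirchSchmidtWingberg2008, (7.2.6) and II §7 (2.7.5)] -/
theorem exists_tatePairingPoint_eq (φ : (W.baseChange F).toAffine.Point →+ ℤ_[p]) :
    ∃ y : continuousCohomology 1 (restrictedTateRep W F p).toTopRep, ∀ P : (W.baseChange F).toAffine.Point,
      tatePairingPoint W F p e hμ hadd₁ hadd₂ hgal hcompat y P = φ P := by
  obtain ⟨x, hxc, hx⟩ := exists_coherent_levelTatePairing_kummerLevelClass_eq W F p e hμ hadd₁ hadd₂ hgal hnondeg hcompat φ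
  obtain ⟨η, hη⟩ := exists_oneCocycle_tateProj_eq W F p x hxc
  refine ⟨oneCocycleClass _ η, fun P => PadicInt.ext_of_toZModPow.mp fun k => ?_⟩
  rw [toZModPow_tatePairingPoint, hη k, hx k P]

end Literature.NumberTheory.EllipticCurves

end
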